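import Summits.CriticalPhenomena.PercolationContinuityZ3.Theorems.PercNearOneGluingNoHeavyLowerTailIncStarBridgeEvents
import Summits.CriticalPhenomena.PercolationContinuityZ3.Theorems.PercNearOneGluingNoHeavyLowerTailIncStarBridgeHalfPoly
import Summits.CriticalPhenomena.PercolationContinuityZ3.Theorems.PercNearOneGluingAdditiveGluingTieLiftOne
import Literature.Probability.Percolation.ShorteningInfluenceBound
import HarnessLib

/-!
# THEOREM B½ (event layer): `F = E₃ − ½(m_abc − m_am_bm_c)` lies above its chords along a 1|2 bridge whose far side satisfies the R-side lemma

Support file for the Sahi programme (`--supports stmt-CriticalPhenomena-4575`, prover prim-sahi-p2 gen 19).  No definitions, no named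
facts, no sorries; standard axioms.  Memo `FROM-prim-nh-lead-4575-g120-STAR-HALF.md` §3, §5 (lead g120: THEOREM B½-forest / C½),
`prim-sahi-p2/PROOF-E3.md` (29h).

Same setting and the same event layer as THEOREM B (`IncStar.incStar_bridge_chord`, `…IncStarBridgeChord`): near side `L ∌ s` with `a, u ∈ L`,
`v, b, c ∉ L`, bridge `e = s(u, v)`, no other positive pair from `L` to `(L ∪ {s})ᶜ`.  Unrestricted bridge concavity of the STAR½ functional
`F` is FALSE (lead §3, a triangle on the far side); the correct hypothesis is the R-SIDE inequality at the far endpoint,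
`RS(w[e↦0]; v; b, c) ≥ 0` (root-connection form, see `…IncStarRSideCases`), which the R-side lemma guarantees on forest far sides under
rule (R).  **`incStar_bridge_chordHalf`**: given `RS(w[e↦0]; v; b, c) ≥ 0`,
`(1 − w e)·F(w[e↦0]) + (w e)·F(w[e↦1]) ≤ F(w)`, `F(μ) = sahiE3 μ A B C − ½(μ(A∩B∩C) − μ(A)μ(B)μ(C))`.  Proof = the moment computations of Theorem B
(cut-vertex dictionary, `insert`-lifting, independence of the blocks, Harris (H2), (H4)), the translation of `RS` into block quantities, and
`IncStar.bridgeChordHalf_poly`.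
-/

noncomputable section

namespace Summit.CriticalPhenomena.PercolationContinuityZ3.Theorems

namespace IncStar

open MeasureTheory Set Literature.Probability.Percolation Literature.Probability.LatticeModels EdgeInduction
open Literature.Probability.Percolation.BlockExploration (mem_openConn_iff_openConnIn_univ)
open scoped Classical

variable {n : ℕ}

/-- **THEOREM B½ (chord form of the STAR½ bridge step, every finite graph, given the R-side inequality at the far endpoint).** [this work] -/
theorem incStar_bridge_chordHalf (w : Sym2 (Fin n) → unitInterval) (L : Set (Fin n)) {s u v a b c : Fin n}
    (hsL : s ∉ L) (huL : u ∈ L) (hvL : v ∉ L) (haL : a ∈ L) (hbL : b ∉ L) (hcL : c ∉ L)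
    (hcross : ∀ x y : Fin n, x ∈ L → y ∉ L → y ≠ s → s(x, y) ≠ s(u, v) → w s(x, y) = 0)
    (hRS : 0 ≤ (prodBernoulli (Function.update w s(u, v) 0)).real (openConn s v) * ((prodBernoulli (Function.update w s(u, v) 0)).real ((openConn b v \ openConn s v) ∩ openConn s c)
          + (prodBernoulli (Function.update w s(u, v) 0)).real ((openConn c v \ openConn s v) ∩ openConn s b) + (prodBernoulli (Function.update w s(u, v) 0)).real ((openConn b v ∩ openConn c v) \ openConn s v))
        + (prodBernoulli (Function.update w s(u, v) 0)).real (openConn b v \ openConn s v) * (prodBernoulli (Function.update w s(u, v) 0)).real (openConn s v ∩ openConn s c) + (prodBernoulli (Function.update w s(u, v) 0)).real (openConn c v \ openConn s v) * (prodBernoulli (Function.update w s(u, v) 0)).real (openConn s v ∩ openConn s b)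
        - 3 / 2 * (prodBernoulli (Function.update w s(u, v) 0)).real (openConn s v) * ((prodBernoulli (Function.update w s(u, v) 0)).real (openConn s b) * (prodBernoulli (Function.update w s(u, v) 0)).real (openConn c v \ openConn s v)
          + (prodBernoulli (Function.update w s(u, v) 0)).real (openConn s c) * (prodBernoulli (Function.update w s(u, v) 0)).real (openConn b v \ openConn s v))
        - 3 * (prodBernoulli (Function.update w s(u, v) 0)).real (openConn s v) * (prodBernoulli (Function.update w s(u, v) 0)).real (openConn b v \ openConn s v) * (prodBernoulli (Function.update w s(u, v) 0)).real (openConn c v \ openConn s v)) :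
    (1 - (w s(u, v) : ℝ)) * (sahiE3 (prodBernoulli (Function.update w s(u, v) 0)) (openConn s a) (openConn s b) (openConn s c)
          - 1 / 2 * ((prodBernoulli (Function.update w s(u, v) 0)).real (openConn s a ∩ openConn s b ∩ openConn s c)
            - (prodBernoulli (Function.update w s(u, v) 0)).real (openConn s a) * (prodBernoulli (Function.update w s(u, v) 0)).real (openConn s b) * (prodBernoulli (Function.update w s(u, v) 0)).real (openConn s c)))
      + (w s(u, v) : ℝ) * (sahiE3 (prodBernoulli (Function.update w s(u, v) 1)) (openConn s a) (openConn s b) (openConn s c)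
          - 1 / 2 * ((prodBernoulli (Function.update w s(u, v) 1)).real (openConn s a ∩ openConn s b ∩ openConn s c)
            - (prodBernoulli (Function.update w s(u, v) 1)).real (openConn s a) * (prodBernoulli (Function.update w s(u, v) 1)).real (openConn s b) * (prodBernoulli (Function.update w s(u, v) 1)).real (openConn s c)))
    ≤ (sahiE3 (prodBernoulli w) (openConn s a) (openConn s b) (openConn s c)
          - 1 / 2 * ((prodBernoulli w).real (openConn s a ∩ openConn s b ∩ openConn s c)
            - (prodBernoulli w).real (openConn s a) * (prodBernoulli w).real (openConn s b) * (prodBernoulli w).real (openConn s c))) := by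
  -- names
  set e : Sym2 (Fin n) := s(u, v)
  set w0 := Function.update w e 0 with hw0
  set w1 := Function.update w e 1
  have hs1 : s ∈ insert s L := Set.mem_insert s L
  have ha1 : a ∈ insert s L := Set.mem_insert_of_mem s haL
  -- the events
  set T : Set (BondConfig (Fin n)) := openConnIn (insert s L) s a
  set S : Set (BondConfig (Fin n)) := openConnIn (insert s L) s u
  set F : Set (BondConfig (Fin n)) := openConnIn (insert s L) u a
  set P' : Set (BondConfig (Fin n)) := openConnIn Lᶜ s v
  set B0 : Set (BondConfig (Fin n)) := openConnIn Lᶜ s b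
  set C0 : Set (BondConfig (Fin n)) := openConnIn Lᶜ s c
  -- (0) the bridge hypothesis under `w0`, and the almost-sure set
  have hw0cross : ∀ x y : Fin n, x ∈ L → y ∉ L → y ≠ s → w0 s(x, y) = 0 := by
    intro x y hx hy hys
    by_cases hxy : s(x, y) = e
    · rw [hxy, hw0, Function.update_self]
    · rw [hw0, Function.update_of_ne hxy]; exact hcross x y hx hy hys hxy
  set G : Set (BondConfig (Fin n)) := {ω | ∀ e', w0 e' = 0 → e' ∉ ω}
  have hG1 : (prodBernoulli w0).real G = 1 := real_sureClosed w0
  have hωG : ∀ ω ∈ G, ∀ x y : Fin n, x ∈ L → y ∉ L → y ≠ s → s(x, y) ∉ ω :=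
    fun ω hω x y hx hy hys => hω _ (hw0cross x y hx hy hys)
  have hm : ∀ X : Set (BondConfig (Fin n)), MeasurableSet X := fun _ => MeasurableSet.of_discrete
  -- (1) coordinates: off-diagonal pairs inside the near block; independence of the two blocks
  set K : Finset (Sym2 (Fin n)) := Finset.univ.filter fun z : Sym2 (Fin n) => ¬ z.IsDiag ∧ ∀ x ∈ z, x ∈ insert s L with hK
  have hKcoe : (↑K : Set (Sym2 (Fin n))) = {z : Sym2 (Fin n) | ¬ z.IsDiag ∧ ∀ x ∈ z, x ∈ insert s L} := by
    ext z; simp [hK]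
  have hdet₁ : ∀ x y : Fin n, DeterminedBy (openConnIn (insert s L) x y : Set (BondConfig (Fin n))) (↑K : Set (Sym2 (Fin n))) := by
    intro x y; rw [hKcoe]; exact IncStarCutVertex.determinedBy_openConnIn_offDiag _ x y
  have hdet₂ : ∀ x y : Fin n, DeterminedBy (openConnIn Lᶜ x y : Set (BondConfig (Fin n))) (↑K : Set (Sym2 (Fin n)))ᶜ := by
    intro x y
    refine (IncStarCutVertex.determinedBy_openConnIn_offDiag Lᶜ x y).mono fun z hz hzK => ?_
    rw [hKcoe] at hzK
    obtain ⟨hnd, hz₂⟩ := hz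
    obtain ⟨-, hz₁⟩ := hzK
    revert hnd hz₁ hz₂
    refine Sym2.inductionOn z fun p q => ?_
    intro hnd hz₂ hz₁
    have hp : p = s := bridge_cv_hV L s p (hz₁ p (Sym2.mem_mk_left p q)) (hz₂ p (Sym2.mem_mk_left p q))
    have hq : q = s := bridge_cv_hV L s q (hz₁ q (Sym2.mem_mk_right p q)) (hz₂ q (Sym2.mem_mk_right p q))
    exact hnd (by rw [Sym2.mk_isDiag_iff, hp, hq])
  have hdiff : ∀ {A B : Set (BondConfig (Fin n))} {K' : Set (Sym2 (Fin n))},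
      DeterminedBy A K' → DeterminedBy B K' → DeterminedBy (A \ B) K' := by
    intro A B K' hA hB
    rw [determinedBy_iff] at hA hB ⊢
    intro ω ω' h
    rw [Set.mem_sdiff, Set.mem_sdiff, hA ω ω' h, hB ω ω' h]
  have indep : ∀ {A B : Set (BondConfig (Fin n))}, DeterminedBy A (↑K : Set (Sym2 (Fin n))) →
      DeterminedBy B (↑K : Set (Sym2 (Fin n)))ᶜ → (prodBernoulli w0).real (A ∩ B) = (prodBernoulli w0).real A * (prodBernoulli w0).real B :=
    fun hA hB => prodBernoulli_real_inter_of_determinedBy w0 K hA hB (hm _) (hm _)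
  have hdT : DeterminedBy T (↑K : Set (Sym2 (Fin n))) := hdet₁ s a
  have hdS : DeterminedBy S (↑K : Set (Sym2 (Fin n))) := hdet₁ s u
  have hdF : DeterminedBy F (↑K : Set (Sym2 (Fin n))) := hdet₁ u a
  have hdP' : DeterminedBy P' (↑K : Set (Sym2 (Fin n)))ᶜ := hdet₂ s v
  have hdB0 : DeterminedBy B0 (↑K : Set (Sym2 (Fin n)))ᶜ := hdet₂ s b
  have hdC0 : DeterminedBy C0 (↑K : Set (Sym2 (Fin n)))ᶜ := hdet₂ s c
  have hdRb : DeterminedBy (openConnIn Lᶜ v b \ B0) (↑K : Set (Sym2 (Fin n)))ᶜ := hdiff (hdet₂ v b) hdB0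
  have hdRc : DeterminedBy (openConnIn Lᶜ v c \ C0) (↑K : Set (Sym2 (Fin n)))ᶜ := hdiff (hdet₂ v c) hdC0
  -- (2) elementary relations between the events
  have hSF_T : ∀ ω, ω ∈ S → ω ∈ F → ω ∈ T := fun ω hS' hF' => PlanarDuality.openConnIn_trans hS' hF'
  have hFT_S : ∀ ω, ω ∈ F → ω ∈ T → ω ∈ S := fun ω hF' hT' => PlanarDuality.openConnIn_trans hT' (openConnIn_symm' hF')
  -- (3) the moments under `w0`
  have m0a : (prodBernoulli w0).real (openConn s a) = (prodBernoulli w0).real T :=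
    real_congr_of_sure hG1 fun ω hω => bridge_conn_ll L hsL (hωG ω hω) hs1 ha1
  have m0b : (prodBernoulli w0).real (openConn s b) = (prodBernoulli w0).real B0 :=
    real_congr_of_sure hG1 fun ω hω => by
      rw [bridge_conn_lr L hsL (hωG ω hω) hs1 hbL]
      exact ⟨fun h => h.2, fun h => ⟨⟨hs1, hs1, SimpleGraph.Reachable.refl _⟩, h⟩⟩
  have m0c : (prodBernoulli w0).real (openConn s c) = (prodBernoulli w0).real C0 :=
    real_congr_of_sure hG1 fun ω hω => by
      rw [bridge_conn_lr L hsL (hωG ω hω) hs1 hcL]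
      exact ⟨fun h => h.2, fun h => ⟨⟨hs1, hs1, SimpleGraph.Reachable.refl _⟩, h⟩⟩
  have m0ab : (prodBernoulli w0).real (openConn s a ∩ openConn s b) = (prodBernoulli w0).real T * (prodBernoulli w0).real B0 := by
    rw [← indep hdT hdB0]
    refine real_congr_of_sure hG1 fun ω hω => ?_
    simp only [Set.mem_inter_iff]
    rw [bridge_conn_ll L hsL (hωG ω hω) hs1 ha1, bridge_conn_lr L hsL (hωG ω hω) hs1 hbL]
    exact ⟨fun h => ⟨h.1, h.2.2⟩, fun h => ⟨h.1, ⟨hs1, hs1, SimpleGraph.Reachable.refl _⟩, h.2⟩⟩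
  have m0ac : (prodBernoulli w0).real (openConn s a ∩ openConn s c) = (prodBernoulli w0).real T * (prodBernoulli w0).real C0 := by
    rw [← indep hdT hdC0]
    refine real_congr_of_sure hG1 fun ω hω => ?_
    simp only [Set.mem_inter_iff]
    rw [bridge_conn_ll L hsL (hωG ω hω) hs1 ha1, bridge_conn_lr L hsL (hωG ω hω) hs1 hcL]
    exact ⟨fun h => ⟨h.1, h.2.2⟩, fun h => ⟨h.1, ⟨hs1, hs1, SimpleGraph.Reachable.refl _⟩, h.2⟩⟩
  have m0bc : (prodBernoulli w0).real (openConn s b ∩ openConn s c) = (prodBernoulli w0).real (B0 ∩ C0) := by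
    refine real_congr_of_sure hG1 fun ω hω => ?_
    simp only [Set.mem_inter_iff]
    rw [bridge_conn_lr L hsL (hωG ω hω) hs1 hbL, bridge_conn_lr L hsL (hωG ω hω) hs1 hcL]
    exact ⟨fun h => ⟨h.1.2, h.2.2⟩, fun h => ⟨⟨⟨hs1, hs1, SimpleGraph.Reachable.refl _⟩, h.1⟩,
      ⟨⟨hs1, hs1, SimpleGraph.Reachable.refl _⟩, h.2⟩⟩⟩
  have m0abc : (prodBernoulli w0).real (openConn s a ∩ openConn s b ∩ openConn s c) = (prodBernoulli w0).real T * (prodBernoulli w0).real (B0 ∩ C0) := by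
    rw [← indep hdT (hdB0.inter hdC0)]
    refine real_congr_of_sure hG1 fun ω hω => ?_
    simp only [Set.mem_inter_iff]
    rw [bridge_conn_ll L hsL (hωG ω hω) hs1 ha1, bridge_conn_lr L hsL (hωG ω hω) hs1 hbL,
      bridge_conn_lr L hsL (hωG ω hω) hs1 hcL]
    exact ⟨fun h => ⟨h.1.1, h.1.2.2, h.2.2⟩, fun h => ⟨⟨h.1, ⟨hs1, hs1, SimpleGraph.Reachable.refl _⟩, h.2.1⟩,
      ⟨hs1, hs1, SimpleGraph.Reachable.refl _⟩, h.2.2⟩⟩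
  -- (4) the moments under `w1`: lift through `insert e`, then decompose into disjoint independent pieces
  have lift : ∀ A : Set (BondConfig (Fin n)), (prodBernoulli w1).real A = (prodBernoulli w0).real ((fun ω : BondConfig (Fin n) => insert e ω) ⁻¹' A) :=
    fun A => tieLiftOne_real_one_eq w e A
  -- pointwise forms of the lifted events on `G`
  have liftA : ∀ ω ∈ G, (insert e ω ∈ openConn s a ↔ ω ∈ T ∨ (ω ∈ F ∧ ω ∉ T ∧ ω ∈ P')) := by
    intro ω hω
    rw [bridge_lift_near L hsL huL hvL haL (hωG ω hω)]
    constructor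
    · rintro (h | ⟨hP, hF'⟩)
      · exact Or.inl h
      · by_cases hT' : ω ∈ T
        · exact Or.inl hT'
        · exact Or.inr ⟨hF', hT', hP⟩
    · rintro (h | ⟨hF', -, hP⟩)
      · exact Or.inl h
      · exact Or.inr ⟨hP, hF'⟩
  have liftFar : ∀ t : Fin n, t ∉ L → ∀ ω ∈ G, (insert e ω ∈ openConn s t ↔
      ω ∈ openConnIn Lᶜ s t ∨ (ω ∈ S ∧ ω ∈ (openConnIn Lᶜ v t \ openConnIn Lᶜ s t))) := by
    intro t htL ω hω
    rw [bridge_lift_far L hsL huL hvL htL (hωG ω hω)]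
    constructor
    · rintro (h | ⟨hS', hR⟩)
      · exact Or.inl h
      · by_cases hB : ω ∈ openConnIn Lᶜ s t
        · exact Or.inl hB
        · exact Or.inr ⟨hS', hR, hB⟩
    · rintro (h | ⟨hS', hR, -⟩)
      · exact Or.inl h
      · exact Or.inr ⟨hS', hR⟩
  have liftB : ∀ ω ∈ G, (insert e ω ∈ openConn s b ↔ ω ∈ B0 ∨ (ω ∈ S ∧ ω ∈ (openConnIn Lᶜ v b \ B0))) := liftFar b hbL
  have liftC : ∀ ω ∈ G, (insert e ω ∈ openConn s c ↔ ω ∈ C0 ∨ (ω ∈ S ∧ ω ∈ (openConnIn Lᶜ v c \ C0))) := liftFar c hcL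
  -- disjoint-union bookkeeping
  have hunion : ∀ {X Y : Set (BondConfig (Fin n))}, Disjoint X Y → (prodBernoulli w0).real (X ∪ Y) = (prodBernoulli w0).real X + (prodBernoulli w0).real Y :=
    fun hXY => measureReal_union hXY (hm _)
  -- m1a = τ + α σ'
  have m1a : (prodBernoulli w1).real (openConn s a) = (prodBernoulli w0).real T + (prodBernoulli w0).real (F \ T) * (prodBernoulli w0).real P' := by
    rw [lift, ← indep (hdiff hdF hdT) hdP', ← hunion]
    · refine real_congr_of_sure hG1 fun ω hω => ?_
      simp only [Set.mem_preimage]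
      rw [liftA ω hω]
      simp only [Set.mem_union, Set.mem_inter_iff, Set.mem_sdiff]
      tauto
    · exact Set.disjoint_left.2 fun ω hT' hx => hx.1.2 hT'
  -- m1b = mb + σ db
  have m1b : (prodBernoulli w1).real (openConn s b) = (prodBernoulli w0).real B0 + (prodBernoulli w0).real S * (prodBernoulli w0).real (openConnIn Lᶜ v b \ B0) := by
    rw [lift, ← indep hdS hdRb, ← hunion]
    · refine real_congr_of_sure hG1 fun ω hω => ?_
      simp only [Set.mem_preimage]
      rw [liftB ω hω]
      simp only [Set.mem_union, Set.mem_inter_iff]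
    · exact Set.disjoint_left.2 fun ω hB hx => hx.2.2 hB
  have m1c : (prodBernoulli w1).real (openConn s c) = (prodBernoulli w0).real C0 + (prodBernoulli w0).real S * (prodBernoulli w0).real (openConnIn Lᶜ v c \ C0) := by
    rw [lift, ← indep hdS hdRc, ← hunion]
    · refine real_congr_of_sure hG1 fun ω hω => ?_
      simp only [Set.mem_preimage]
      rw [liftC ω hω]
      simp only [Set.mem_union, Set.mem_inter_iff]
    · exact Set.disjoint_left.2 fun ω hC hx => hx.2.2 hC
  -- m1ab = τ mb + P(T∩S) db + α yb
  have m1ab : (prodBernoulli w1).real (openConn s a ∩ openConn s b) =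
      (prodBernoulli w0).real T * (prodBernoulli w0).real B0 + (prodBernoulli w0).real (T ∩ S) * (prodBernoulli w0).real (openConnIn Lᶜ v b \ B0) + (prodBernoulli w0).real (F \ T) * (prodBernoulli w0).real (P' ∩ B0) := by
    rw [lift, ← indep hdT hdB0, ← indep (hdT.inter hdS) hdRb, ← indep (hdiff hdF hdT) (hdP'.inter hdB0),
      ← hunion, ← hunion]
    · refine real_congr_of_sure hG1 fun ω hω => ?_
      simp only [Set.preimage_inter, Set.mem_inter_iff, Set.mem_preimage]
      rw [liftA ω hω, liftB ω hω]
      simp only [Set.mem_union, Set.mem_inter_iff, Set.mem_sdiff]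
      constructor
      · rintro ⟨hA | ⟨hF', hnT, hP⟩, hB | ⟨hS', hR⟩⟩
        · exact Or.inl (Or.inl ⟨hA, hB⟩)
        · exact Or.inl (Or.inr ⟨⟨hA, hS'⟩, hR⟩)
        · exact Or.inr ⟨⟨hF', hnT⟩, hP, hB⟩
        · exact absurd (hSF_T ω hS' hF') hnT
      · rintro ((⟨hA, hB⟩ | ⟨⟨hA, hS'⟩, hR⟩) | ⟨⟨hF', hnT⟩, hP, hB⟩)
        · exact ⟨Or.inl hA, Or.inl hB⟩
        · exact ⟨Or.inl hA, Or.inr ⟨hS', hR⟩⟩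
        · exact ⟨Or.inr ⟨hF', hnT, hP⟩, Or.inl hB⟩
    · exact Set.disjoint_left.2 fun ω h1 h2 => by
        rcases h1 with ⟨hA, -⟩ | ⟨⟨hA, -⟩, -⟩ <;> exact h2.1.2 hA
    · exact Set.disjoint_left.2 fun ω h1 h2 => h2.2.2 h1.2
  have m1ac : (prodBernoulli w1).real (openConn s a ∩ openConn s c) =
      (prodBernoulli w0).real T * (prodBernoulli w0).real C0 + (prodBernoulli w0).real (T ∩ S) * (prodBernoulli w0).real (openConnIn Lᶜ v c \ C0) + (prodBernoulli w0).real (F \ T) * (prodBernoulli w0).real (P' ∩ C0) := by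
    rw [lift, ← indep hdT hdC0, ← indep (hdT.inter hdS) hdRc, ← indep (hdiff hdF hdT) (hdP'.inter hdC0),
      ← hunion, ← hunion]
    · refine real_congr_of_sure hG1 fun ω hω => ?_
      simp only [Set.preimage_inter, Set.mem_inter_iff, Set.mem_preimage]
      rw [liftA ω hω, liftC ω hω]
      simp only [Set.mem_union, Set.mem_inter_iff, Set.mem_sdiff]
      constructor
      · rintro ⟨hA | ⟨hF', hnT, hP⟩, hC | ⟨hS', hR⟩⟩
        · exact Or.inl (Or.inl ⟨hA, hC⟩)
        · exact Or.inl (Or.inr ⟨⟨hA, hS'⟩, hR⟩)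
        · exact Or.inr ⟨⟨hF', hnT⟩, hP, hC⟩
        · exact absurd (hSF_T ω hS' hF') hnT
      · rintro ((⟨hA, hC⟩ | ⟨⟨hA, hS'⟩, hR⟩) | ⟨⟨hF', hnT⟩, hP, hC⟩)
        · exact ⟨Or.inl hA, Or.inl hC⟩
        · exact ⟨Or.inl hA, Or.inr ⟨hS', hR⟩⟩
        · exact ⟨Or.inr ⟨hF', hnT, hP⟩, Or.inl hC⟩
    · exact Set.disjoint_left.2 fun ω h1 h2 => by
        rcases h1 with ⟨hA, -⟩ | ⟨⟨hA, -⟩, -⟩ <;> exact h2.1.2 hA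
    · exact Set.disjoint_left.2 fun ω h1 h2 => h2.2.2 h1.2
  -- m1bc = mbc + σ (ξc + ξb + dbc)
  have m1bc : (prodBernoulli w1).real (openConn s b ∩ openConn s c) =
      (prodBernoulli w0).real (B0 ∩ C0) + (prodBernoulli w0).real S * (prodBernoulli w0).real (B0 ∩ (openConnIn Lᶜ v c \ C0)) + (prodBernoulli w0).real S * (prodBernoulli w0).real ((openConnIn Lᶜ v b \ B0) ∩ C0)
        + (prodBernoulli w0).real S * (prodBernoulli w0).real ((openConnIn Lᶜ v b \ B0) ∩ (openConnIn Lᶜ v c \ C0)) := by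
    rw [lift, ← indep hdS (hdB0.inter hdRc), ← indep hdS (hdRb.inter hdC0), ← indep hdS (hdRb.inter hdRc),
      ← hunion, ← hunion, ← hunion]
    · refine real_congr_of_sure hG1 fun ω hω => ?_
      simp only [Set.preimage_inter, Set.mem_inter_iff, Set.mem_preimage]
      rw [liftB ω hω, liftC ω hω]
      simp only [Set.mem_union, Set.mem_inter_iff]
      constructor
      · rintro ⟨hB | ⟨hS', hRb'⟩, hC | ⟨hS'', hRc'⟩⟩
        · exact Or.inl (Or.inl (Or.inl ⟨hB, hC⟩))
        · exact Or.inl (Or.inl (Or.inr ⟨hS'', hB, hRc'⟩))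
        · exact Or.inl (Or.inr ⟨hS', hRb', hC⟩)
        · exact Or.inr ⟨hS', hRb', hRc'⟩
      · rintro (((⟨hB, hC⟩ | ⟨hS', hB, hRc'⟩) | ⟨hS', hRb', hC⟩) | ⟨hS', hRb', hRc'⟩)
        · exact ⟨Or.inl hB, Or.inl hC⟩
        · exact ⟨Or.inl hB, Or.inr ⟨hS', hRc'⟩⟩
        · exact ⟨Or.inr ⟨hS', hRb'⟩, Or.inl hC⟩
        · exact ⟨Or.inr ⟨hS', hRb'⟩, Or.inr ⟨hS', hRc'⟩⟩
    · exact Set.disjoint_left.2 fun ω h1 h2 => by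
        rcases h1 with (⟨hB, -⟩ | ⟨-, hB, -⟩) | ⟨-, -, hC⟩
        · exact h2.2.1.2 hB
        · exact h2.2.1.2 hB
        · exact h2.2.2.2 hC
    · exact Set.disjoint_left.2 fun ω h1 h2 => by
        rcases h1 with ⟨hB, -⟩ | ⟨-, hB, -⟩ <;> exact h2.2.1.2 hB
    · exact Set.disjoint_left.2 fun ω h1 h2 => h2.2.2.2 h1.2
  -- (5) the four classical inequalities
  have hup : ∀ (X : Set (Fin n)) (x y : Fin n), IsUpperSet (openConnIn X x y : Set (BondConfig (Fin n))) :=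
    fun X x y => isUpperSet_openConnIn X x y
  have hHarris : ∀ {A B : Set (BondConfig (Fin n))}, IsUpperSet A → IsUpperSet B →
      (prodBernoulli w0).real A * (prodBernoulli w0).real B ≤ (prodBernoulli w0).real (A ∩ B) := fun hA hB => prodBernoulli_harris w0 hA hB (hm _) (hm _)
  have H2 : (prodBernoulli w0).real T * (prodBernoulli w0).real S ≤ (prodBernoulli w0).real (T ∩ S) := hHarris (hup _ _ _) (hup _ _ _)
  have hSF : S ∩ F = F ∩ T := by
    ext ω
    simp only [Set.mem_inter_iff]
    exact ⟨fun h => ⟨h.2, hSF_T ω h.1 h.2⟩, fun h => ⟨hFT_S ω h.1 h.2, h.1⟩⟩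
  have hFsplit : (prodBernoulli w0).real F = (prodBernoulli w0).real (F ∩ T) + (prodBernoulli w0).real (F \ T) := (measureReal_inter_add_sdiff (hm T)).symm
  have H4 : (prodBernoulli w0).real S * ((prodBernoulli w0).real (F \ T) + (prodBernoulli w0).real (F ∩ T)) ≤ (prodBernoulli w0).real (F ∩ T) := by
    have h := hHarris (hup _ _ _ : IsUpperSet S) (hup _ _ _ : IsUpperSet F)
    rw [hSF, hFsplit] at h
    linarith
  have hK : (prodBernoulli w0).real (F ∩ T) ≤ (prodBernoulli w0).real (T ∩ S) :=
    measureReal_mono fun ω h => ⟨h.2, hFT_S ω h.1 h.2⟩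
  -- sign conditions
  have hσ'1 : (prodBernoulli w0).real P' ≤ 1 := measureReal_le_one
  have hp0 : (0 : ℝ) ≤ w e := (w e).2.1
  have hp1 : (w e : ℝ) ≤ 1 := (w e).2.2
  -- (6) one-bond decomposition of the seven moments of `P_w`
  have ob : ∀ A : Set (BondConfig (Fin n)),
      (prodBernoulli w).real A = (1 - (w e : ℝ)) * (prodBernoulli w0).real A + (w e : ℝ) * (prodBernoulli w1).real A := by
    intro A
    have hA : DeterminedBy A (↑(Finset.univ : Finset (Sym2 (Fin n))) : Set (Sym2 (Fin n))) := by
      rw [determinedBy_iff]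
      intro ω ω' h
      rw [Finset.coe_univ, Set.inter_univ, Set.inter_univ] at h
      rw [h]
    exact prodBernoulli_real_oneBond hA w (Finset.mem_univ e)
  -- (7) the R-side hypothesis in block form
  have rsv : ∀ ω ∈ G, (ω ∈ openConn s v ↔ ω ∈ P') := fun ω hω => by
    rw [bridge_conn_lr L hsL (hωG ω hω) hs1 hvL]; exact ⟨fun h => h.2, fun h => ⟨⟨hs1, hs1, SimpleGraph.Reachable.refl _⟩, h⟩⟩
  have rσ : (prodBernoulli w0).real (openConn s v) = (prodBernoulli w0).real P' := real_congr_of_sure hG1 rsv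
  have rfar : ∀ ω ∈ G, ∀ t : Fin n, t ∉ L →
      (ω ∈ openConn t v \ openConn s v ↔ ω ∈ openConnIn Lᶜ v t \ openConnIn Lᶜ s t) := by
    intro ω hω t ht
    rw [Set.mem_sdiff, Set.mem_sdiff, bridge_conn_rr L hsL (hωG ω hω) ht hvL, bridge_conn_lr L hsL (hωG ω hω) hs1 hvL]
    constructor
    · rintro ⟨hR, hn⟩
      exact ⟨openConnIn_symm' hR, fun hB => hn ⟨⟨hs1, hs1, SimpleGraph.Reachable.refl _⟩, PlanarDuality.openConnIn_trans hB hR⟩⟩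
    · rintro ⟨hR, hn⟩
      exact ⟨openConnIn_symm' hR, fun hP => hn (PlanarDuality.openConnIn_trans hP.2 hR)⟩
  have rsc : ∀ ω ∈ G, ∀ t : Fin n, t ∉ L → (ω ∈ openConn s t ↔ ω ∈ openConnIn Lᶜ s t) := fun ω hω t ht => by
    rw [bridge_conn_lr L hsL (hωG ω hω) hs1 ht]; exact ⟨fun h => h.2, fun h => ⟨⟨hs1, hs1, SimpleGraph.Reachable.refl _⟩, h⟩⟩
  have rdb : (prodBernoulli w0).real (openConn b v \ openConn s v) = (prodBernoulli w0).real (openConnIn Lᶜ v b \ B0) :=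
    real_congr_of_sure hG1 fun ω hω => rfar ω hω b hbL
  have rdc : (prodBernoulli w0).real (openConn c v \ openConn s v) = (prodBernoulli w0).real (openConnIn Lᶜ v c \ C0) :=
    real_congr_of_sure hG1 fun ω hω => rfar ω hω c hcL
  have rdbc : (prodBernoulli w0).real ((openConn b v ∩ openConn c v) \ openConn s v)
      = (prodBernoulli w0).real ((openConnIn Lᶜ v b \ B0) ∩ (openConnIn Lᶜ v c \ C0)) :=
    real_congr_of_sure hG1 fun ω hω => by
      have hb' := rfar ω hω b hbL
      have hc' := rfar ω hω c hcL
      rw [Set.mem_sdiff] at hb' hc'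
      rw [Set.mem_sdiff, Set.mem_inter_iff, Set.mem_inter_iff, ← hb', ← hc']
      tauto
  have rxb : (prodBernoulli w0).real ((openConn b v \ openConn s v) ∩ openConn s c)
      = (prodBernoulli w0).real ((openConnIn Lᶜ v b \ B0) ∩ C0) :=
    real_congr_of_sure hG1 fun ω hω => by rw [Set.mem_inter_iff, Set.mem_inter_iff, rfar ω hω b hbL, rsc ω hω c hcL]
  have rxc : (prodBernoulli w0).real ((openConn c v \ openConn s v) ∩ openConn s b)
      = (prodBernoulli w0).real (B0 ∩ (openConnIn Lᶜ v c \ C0)) :=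
    real_congr_of_sure hG1 fun ω hω => by rw [Set.mem_inter_iff, Set.mem_inter_iff, rfar ω hω c hcL, rsc ω hω b hbL, and_comm]
  have ryb : (prodBernoulli w0).real (openConn s v ∩ openConn s b) = (prodBernoulli w0).real (P' ∩ B0) :=
    real_congr_of_sure hG1 fun ω hω => by rw [Set.mem_inter_iff, Set.mem_inter_iff, rsv ω hω, rsc ω hω b hbL]
  have ryc : (prodBernoulli w0).real (openConn s v ∩ openConn s c) = (prodBernoulli w0).real (P' ∩ C0) :=
    real_congr_of_sure hG1 fun ω hω => by rw [Set.mem_inter_iff, Set.mem_inter_iff, rsv ω hω, rsc ω hω c hcL]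
  rw [rσ, rdbc, rxb, rxc, rdb, rdc, ryb, ryc, m0b, m0c] at hRS
  -- (8) assemble
  rw [sahiE3_def, sahiE3_def, sahiE3_def, ob (openConn s a ∩ openConn s b ∩ openConn s c), ob (openConn s a), ob (openConn s b),
    ob (openConn s c), ob (openConn s b ∩ openConn s c), ob (openConn s a ∩ openConn s c), ob (openConn s a ∩ openConn s b),
    m0abc, m0a, m0b, m0c, m0bc, m0ac, m0ab, m1a, m1b, m1c, m1bc, m1ac, m1ab]
  have key := bridgeChordHalf_poly (w e) ((prodBernoulli w0).real T) ((prodBernoulli w0).real B0) ((prodBernoulli w0).real C0)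
    ((prodBernoulli w0).real (B0 ∩ C0)) ((prodBernoulli w1).real (openConn s a ∩ openConn s b ∩ openConn s c))
    ((prodBernoulli w0).real (F \ T)) ((prodBernoulli w0).real (F ∩ T)) ((prodBernoulli w0).real S) ((prodBernoulli w0).real (T ∩ S))
    ((prodBernoulli w0).real P') ((prodBernoulli w0).real (openConnIn Lᶜ v b \ B0)) ((prodBernoulli w0).real (openConnIn Lᶜ v c \ C0))
    ((prodBernoulli w0).real ((openConnIn Lᶜ v b \ B0) ∩ (openConnIn Lᶜ v c \ C0))) ((prodBernoulli w0).real ((openConnIn Lᶜ v b \ B0) ∩ C0))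
    ((prodBernoulli w0).real (B0 ∩ (openConnIn Lᶜ v c \ C0))) ((prodBernoulli w0).real (P' ∩ B0)) ((prodBernoulli w0).real (P' ∩ C0))
    hp0 hp1 measureReal_nonneg measureReal_nonneg measureReal_nonneg measureReal_nonneg hσ'1 hK measureReal_nonneg measureReal_nonneg
    H2 H4 hRS
  linarith [key]

end IncStar

end Summit.CriticalPhenomena.PercolationContinuityZ3.Theorems
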